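import Mathlib
import Summits.QuantumFields.QCD.Theses.PauliWegnerSea
import Literature.MathematicalPhysics.QuantumFieldTheory.QCDHeavyQuarkPropagator
import Literature.MathematicalPhysics.QuantumFieldTheory.QCDWickMinorMeasurability
import Literature.MathematicalPhysics.QuantumFieldTheory.QCDPhaseQuenchedPositivity
import Literature.MathematicalPhysics.QuantumFieldTheory.QCDCurrentSector
import Literature.MathematicalPhysics.QuantumFieldTheory.FermiFlavourPhase
import Literature.MathematicalPhysics.QuantumFieldTheory.QCDPhaseQuenchedReweighting
import Literature.MathematicalPhysics.QuantumFieldTheory.QCDPropagatorParity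
import Literature.MathematicalPhysics.QuantumLattice.GrassmannGaussianWordWick
import Literature.MathematicalPhysics.QuantumLattice.GrassmannGaussianMoments
import Literature.MathematicalPhysics.QuantumLattice.DuhamelTwoPoint

/-!
# Stub `stub_pionSecondMomentDecay_of_crux` of line `crossing-split-integrability`
(crux `Summit.QuantumFields.QCD.Theses.PauliWegnerSea.PhaseQuenchedFlavourDecay` =
`Summit.QuantumFields.QCD.Theses.WilsonMobilityGap.PhaseQuenchedFlavourDecay`, item stmt-QuantumFields-9151)

**NECESSITY direction of the crux analysis: the crux contains the uniform exponential decay of the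
phase-quenched PION SECOND MOMENT.**  For every flavour `f` with a mass-degenerate partner `g ≠ f`
(`m_f = m_g`), applying the conclusion of the crux to the flavour-charged pseudoscalar pair
`A = (ψ̄_g γ₅ ψ_f)(0)` (`pseudoscalarDensityObs Nf (Matrix.single g f 1)`, `U(1)_f` charge `+1`) and
`B = (ψ̄_f γ₅ ψ_g)(n e₀)` gives, eventually in `k` and for all `S ≥ L_k`, `n ≤ S`,
`E₊[Σ_{a,i,b,j} |G_f((0,a,i),(n e₀,b,j))|²] ≤ C' e^{-δ' a_k n}` with the crux's own rate `δ'`.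

The heart is the configuration-wise Wick contraction (`pionPair_fermiRatio_eq`): in every gauge
background `U` (torus of any side, any real bare masses with `m_f = m_g`),
`∫ A B e^{-ψ̄Dψ} / ∫ e^{-ψ̄Dψ} = −Σ_{a,i,b,j} |G_f((x,a,i),(y,b,j))|²`, `G = D⁻¹`:
* the pair-ordered four-fermion word integrates to the `2 × 2` Wick determinant
  (`grassmannGaussian_wick` at `k = 2`, weight `e^{ψ̄(−D)ψ}`, `(−D)⁻¹ = −D⁻¹`; `fermiIntegral_pairWord_div`);
* the direct contractions are between different flavours and vanish (`inv_diracMatrix_apply_eq_zero_of_fst_ne`),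
  the crossed one is `−G_f(x→y) G_g(y→x)` and `G_g = G_f` blockwise at equal masses
  (`inv_diracMatrix_apply_same_flavour`);
* γ₅-hermiticity `(D⁻¹)ᴴ = Γ₅ D⁻¹ Γ₅` (tree `diracMatrix_signConj`, `conjTranspose_inv_of_signConj`) reads
  entrywise `G(Q,P) = ε_Q conj(G(P,Q)) ε_P` (`inv_diracMatrix_apply_swap`), and with the tree's DIAGONAL
  `γ₅ = diag(ε)`, `ε² = 1`, every term is `−|G_f(P,Q)|²`;
* for `det D = 0` both sides are the junk value `0` (`x / 0 = 0`, `D⁻¹ = 0`).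
Assembly: the complex quotient of the crux is `⟨·⟩₊` (`qcdPhaseQuenchedExpect_eq_div_complex`,
`qcdPhaseQuenchedExpect_eq_integral_qcdLatticeMeasure`), the integrand is `−(real sum : ℂ)`, and
`⟨X⟩₊ ≤ |⟨X⟩₊| = ‖−(⟨X⟩₊ : ℂ)‖` (`integral_neg`, `integral_complex_ofReal`).

Sources: I. Montvay, G. Münster, *Quantum Fields on a Lattice* (CUP 1994), §4.1.3 (4.25) (Wick rule),
§5.1.2 (5.15) (γ₅-hermiticity), §5.1.1 (5.6) (flavour symmetry); V. Mastropietro, *Non-Perturbative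
Renormalization* (2008), Ch. 2 (2.12), (2.30).
-/

noncomputable section

namespace Summit.QuantumFields.QCD.Cruxes.PhaseQuenchedFlavourDecay.CrossingSplitIntegrability

open scoped BigOperators
open MeasureTheory Filter
open Literature.MathematicalPhysics.QuantumFieldTheory Literature.MathematicalPhysics.QuantumLattice
  Literature.Probability.LatticeModels

/-- **Wick rule for one pair-ordered four-fermion word** in the lattice-QCD Grassmann algebra, normalised by
the fermionic partition function: for `det D(U) ≠ 0`,
`∫ (ψ̄_{i₁} ψ_{j₁})(ψ̄_{i₂} ψ_{j₂}) e^{-ψ̄Dψ} / ∫ e^{-ψ̄Dψ} = G_{j₁i₁} G_{j₂i₂} − G_{j₁i₂} G_{j₂i₁}`, `G = D⁻¹`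
(the two signs of `(-D)⁻¹ = -D⁻¹` cancel in each product). -/
theorem fermiIntegral_pairWord_div {Nf L : ℕ} [NeZero L] (U : GaugeConfig 4 L SU3) (mq : Fin Nf → ℝ)
    (hD : (diracMatrix U mq).det ≠ 0) (i₁ j₁ i₂ j₂ : QuarkVar Nf L) :
    fermiIntegral (qbar i₁ * q j₁ * (qbar i₂ * q j₂) * fermiBoltzmann U mq) /
        fermiIntegral (fermiBoltzmann U mq) =
      (diracMatrix U mq)⁻¹ (quarkEquiv j₁) (quarkEquiv i₁) *
          (diracMatrix U mq)⁻¹ (quarkEquiv j₂) (quarkEquiv i₂) -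
        (diracMatrix U mq)⁻¹ (quarkEquiv j₁) (quarkEquiv i₂) *
          (diracMatrix U mq)⁻¹ (quarkEquiv j₂) (quarkEquiv i₁) := by
  set D := diracMatrix U mq with hDdef
  have hD' : (-D).det ≠ 0 := by
    rw [Matrix.det_neg]
    exact mul_ne_zero (pow_ne_zero _ (neg_ne_zero.2 one_ne_zero)) hD
  have h := grassmannGaussian_wick ℂ (-D) hD' ![quarkEquiv i₁, quarkEquiv i₂]
    ![quarkEquiv j₁, quarkEquiv j₂]
  simp only [List.ofFn_succ, List.ofFn_zero, List.prod_cons, List.prod_nil, mul_one,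
    Matrix.det_fin_two, Matrix.of_apply, Matrix.cons_val_zero, Matrix.cons_val_one,
    Matrix.cons_val_succ] at h
  simp only [fermiIntegral, fermiBoltzmann, qbar, q]
  rw [mul_grassmannExp_quadratic_comm, ← hDdef, h, inv_neg_of_isUnit_det D (Ne.isUnit hD)]
  simp only [Matrix.neg_apply]
  ring

/-- **γ₅-hermiticity, entrywise**: `G(Q,P) = ε_Q · conj(G(P,Q)) · ε_P` with `ε` the `γ₅` sign of the spin index
(`(D⁻¹)ᴴ = diag(ε) D⁻¹ diag(ε)`, tree `diracMatrix_signConj`). -/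
theorem inv_diracMatrix_apply_swap {Nf L : ℕ} [NeZero L] (U : GaugeConfig 4 L SU3) (mq : Fin Nf → ℝ)
    (P Q : FermiIdx Nf L) :
    (diracMatrix U mq)⁻¹ Q P =
      (![1, 1, -1, -1] : Fin 4 → ℂ) (quarkEquiv.symm Q).2.2.2 *
          star ((diracMatrix U mq)⁻¹ P Q) *
        (![1, 1, -1, -1] : Fin 4 → ℂ) (quarkEquiv.symm P).2.2.2 := by
  have h := conjTranspose_inv_of_signConj
    (fun P : FermiIdx Nf L => (![1, 1, -1, -1] : Fin 4 → ℂ) (quarkEquiv.symm P).2.2.2)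
    (fun R => gammaFiveSign_mul_self ((quarkEquiv.symm R).2.2.2)) (diracMatrix U mq)
    (diracMatrix_signConj U mq)
  have h' := congr_fun (congr_fun h Q) P
  rw [Matrix.conjTranspose_apply, Matrix.mul_diagonal, Matrix.diagonal_mul] at h'
  -- `h' : star (G P Q) = ε Q * G Q P * ε P`
  rw [h']
  have hQ := gammaFiveSign_mul_self ((quarkEquiv.symm Q).2.2.2)
  have hP := gammaFiveSign_mul_self ((quarkEquiv.symm P).2.2.2)
  set eQ := (![1, 1, -1, -1] : Fin 4 → ℂ) (quarkEquiv.symm Q).2.2.2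
  set eP := (![1, 1, -1, -1] : Fin 4 → ℂ) (quarkEquiv.symm P).2.2.2
  linear_combination (-((diracMatrix U mq)⁻¹ Q P) * eP * eP) * hQ + (-((diracMatrix U mq)⁻¹ Q P)) * hP

/-- The torus bilinear with a DIAGONAL spin matrix and unit colour matrix: `Σ_{a,α} d_α ψ̄_{f,x,a,α} ψ_{g,y,a,α}`. -/
theorem torusBilinear_diagonal_one {Nf L : ℕ} [NeZero L] (f g : Fin Nf) (x y : TorusSite 4 L)
    (d : Fin 4 → ℂ) :
    torusBilinear f g x y (Matrix.diagonal d) 1 =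
      ∑ a : Fin 3, ∑ α : Fin 4, d α • (qbar (f, (x, a, α)) * q (g, (y, a, α))) := by
  simp only [torusBilinear, Matrix.diagonal_apply, Matrix.one_apply, mul_ite,
    mul_one, mul_zero, ite_smul, zero_smul, Finset.sum_ite_irrel, Finset.sum_const_zero,
    Finset.sum_ite_eq, Finset.mem_univ, if_true]
  exact Finset.sum_comm

/-- **The Wick contraction of the flavoured pseudoscalar pair** `(ψ̄_g γ₅ ψ_f)(x) · (ψ̄_f γ₅ ψ_g)(y)`, `f ≠ g`,
at DEGENERATE bare masses `m_f = m_g`, in every gauge background: the normalised Berezin integral is MINUS the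
colour–spin sum of squared moduli of the flavour-`f` propagator from `x` to `y`,
`⟨(ψ̄_g γ₅ ψ_f)(x) (ψ̄_f γ₅ ψ_g)(y)⟩_F = −Σ_{a,i,b,j} |G_f((x,a,i),(y,b,j))|²`
(only the crossed contraction survives since `G` is flavour-diagonal; `G_g = G_f` as one-flavour blocks;
γ₅-hermiticity `G(Q,P) = ε_Q conj(G(P,Q)) ε_P` and `γ₅ = diag(ε)`, `ε² = 1`).  For `det D = 0` both sides are the
junk value `0`. -/
theorem pionPair_fermiRatio_eq {Nf L : ℕ} [NeZero L] (U : GaugeConfig 4 L SU3) (mq : Fin Nf → ℝ)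
    {f g : Fin Nf} (hfg : f ≠ g) (hm : mq f = mq g) (x y : TorusSite 4 L) :
    fermiIntegral (torusBilinear g f x x gammaFive 1 * torusBilinear f g y y gammaFive 1 *
          fermiBoltzmann U mq) / fermiIntegral (fermiBoltzmann U mq) =
      -(((∑ a : Fin 3, ∑ i : Fin 4, ∑ b : Fin 3, ∑ j : Fin 4,
          ‖(diracMatrix U mq)⁻¹ (quarkEquiv (f, (x, a, i))) (quarkEquiv (f, (y, b, j)))‖ ^ (2 : ℕ) : ℝ) : ℂ)) := by
  by_cases hD : (diracMatrix U mq).det = 0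
  · -- junk case: `Z_F = 0` and `D⁻¹ = 0`
    have hZ : fermiIntegral (fermiBoltzmann U mq) = 0 := by
      rw [fermiIntegral_fermiBoltzmann, hD, mul_zero]
    have hinv : (diracMatrix U mq)⁻¹ = 0 :=
      Matrix.nonsing_inv_apply_not_isUnit _ (by rw [hD]; exact not_isUnit_zero)
    rw [hZ, div_zero, hinv]
    simp
  -- invertible case
  have hall : ∀ f', (wilsonDirac (fundamentalRep (Fin 3)) U (mq f') 1).det ≠ 0 := by
    intro f'
    have h := hD
    rw [det_diracMatrix] at h
    exact (Finset.prod_ne_zero_iff.1 h) f' (Finset.mem_univ _)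
  rw [gammaFive_eq_diagonal, torusBilinear_diagonal_one, torusBilinear_diagonal_one]
  -- expand the product of the two bilinears keeping the sum order `a, α, b, β`
  simp only [Finset.sum_mul]
  simp only [Finset.mul_sum]
  simp only [Finset.sum_mul, smul_mul_assoc, mul_smul_comm, map_sum, map_smul, smul_eq_mul,
    Finset.sum_div, mul_div_assoc, Complex.ofReal_sum, ← Finset.sum_neg_distrib]
  refine Finset.sum_congr rfl fun a _ => Finset.sum_congr rfl fun α _ =>
    Finset.sum_congr rfl fun b _ => Finset.sum_congr rfl fun β _ => ?_
  rw [fermiIntegral_pairWord_div U mq hD,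
    inv_diracMatrix_apply_eq_zero_of_fst_ne U mq (v := (f, (x, a, α))) (w := (g, (x, a, α))) hfg,
    inv_diracMatrix_apply_eq_zero_of_fst_ne U mq (v := (g, (y, b, β))) (w := (f, (y, b, β))) (Ne.symm hfg),
    inv_diracMatrix_apply_same_flavour U mq hall g (y, b, β) (x, a, α), ← hm,
    ← inv_diracMatrix_apply_same_flavour U mq hall f (y, b, β) (x, a, α),
    inv_diracMatrix_apply_swap U mq (quarkEquiv (f, (x, a, α))) (quarkEquiv (f, (y, b, β)))]
  simp only [Equiv.symm_apply_apply]
  have hα := gammaFiveSign_mul_self α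
  have hβ := gammaFiveSign_mul_self β
  have hns := Matrix.mul_star_eq_normSq_cast
    ((diracMatrix U mq)⁻¹ (quarkEquiv (f, (x, a, α))) (quarkEquiv (f, (y, b, β))))
  set G := (diracMatrix U mq)⁻¹ (quarkEquiv (f, (x, a, α))) (quarkEquiv (f, (y, b, β)))
  set sα := (![1, 1, -1, -1] : Fin 4 → ℂ) α
  set sβ := (![1, 1, -1, -1] : Fin 4 → ℂ) β
  linear_combination (-(sβ * sβ) * (G * star G)) * hα + (-(G * star G)) * hβ - hns

/-- **The flavoured pseudoscalar density `ψ̄_g γ₅ ψ_f` (`f ≠ g`) has `U(1)_f` charge `+1`**: under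
`ψ_f ↦ e^{iθ}ψ_f`, `ψ̄_f ↦ e^{-iθ}ψ̄_f` (other flavours fixed) it is multiplied by `e^{iθ}`. -/
theorem isFlavourCharged_pseudoscalarDensityObs_single {Nf : ℕ} {f g : Fin Nf} (hfg : f ≠ g) :
    (pseudoscalarDensityObs Nf (Matrix.single g f (1 : ℂ))).IsFlavourCharged f 1 := by
  intro θ U
  have hgf : ¬(g = f) := Ne.symm hfg
  rw [pseudoscalarDensityObs_F]
  simp only [Matrix.single_apply, ite_and, ite_smul, one_smul, zero_smul, Finset.sum_ite_irrel,
    Finset.sum_const_zero, Finset.sum_ite_eq, Finset.mem_univ, if_true]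
  simp only [boxBilinear, map_sum, map_smul, map_mul, boxQbar, boxQ, fermiFlavourPhase_psiBar,
    fermiFlavourPhase_psi, Equiv.symm_apply_apply, hgf, if_false, if_true, one_smul, mul_smul_comm,
    Finset.smul_sum, smul_smul]
  refine Finset.sum_congr rfl fun α _ => Finset.sum_congr rfl fun β _ =>
    Finset.sum_congr rfl fun a _ => Finset.sum_congr rfl fun b _ => ?_
  congr 1
  push_cast
  ring

/-- **The flavoured pseudoscalar density placed at `v` on the torus**: `(ψ̄_g γ₅ ψ_f)(v mod S)` in torus variables. -/
theorem pseudoscalarDensityObs_single_onTorus {Nf S : ℕ} [NeZero S] (f g : Fin Nf)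
    (v : Literature.Probability.LatticeModels.Site 4) (U : GaugeConfig 4 S SU3) :
    (pseudoscalarDensityObs Nf (Matrix.single g f (1 : ℂ))).onTorus S v U =
      torusBilinear g f (Torus.proj S v) (Torus.proj S v) gammaFive 1 := by
  rw [pseudoscalarDensityObs, localBilinearObs_onTorus]
  simp only [Matrix.single_apply, ite_and, ite_smul, one_smul, zero_smul, Finset.sum_ite_irrel,
    Finset.sum_const_zero, Finset.sum_ite_eq, Finset.mem_univ, if_true, coe_boxOrigin, zero_add]

/-- W7: NECESSITY — the crux contains the uniform exponential decay of the phase-quenched PION second moment E₊‖G_f(0, n e₀)‖²_F for every flavour with a degenerate partner (Wick contraction of the flavoured pseudoscalar pair + γ₅-hermiticity). -/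
theorem stub_pionSecondMomentDecay_of_crux :
    Summit.QuantumFields.QCD.Theses.PauliWegnerSea.PhaseQuenchedFlavourDecay → ∀ (Nf : ℕ) (reg : QCDRegularisation Nf) (m : Fin Nf → ℝ), (∀ f, 0 < m f) → ∀ (f g : Fin Nf), f ≠ g → m f = m g → (∃ s δ C : ℝ, 0 < s ∧ s < 1 ∧ 0 < δ ∧ ∀ᶠ k in atTop, ∀ S : ℕ, reg.L k ≤ S → ∀ (f : Fin Nf) (v : Literature.Probability.LatticeModels.Site 4), v ∈ box 4 S → (∫ U : GaugeConfig 4 (2 * S + 1) (Matrix.specialUnitaryGroup (Fin 3) ℂ), ‖(diracMatrix U fun fl => reg.mcrit k + reg.a k * m fl / reg.Zm k).det‖ * (∑ a : Fin 3, ∑ i : Fin 4, ∑ b : Fin 3, ∑ j : Fin 4, ‖(diracMatrix U fun fl => reg.mcrit k + reg.a k * m fl / reg.Zm k)⁻¹ (quarkEquiv (f, (Torus.proj (2 * S + 1) 0, a, i))) (quarkEquiv (f, (Torus.proj (2 * S + 1) (v), b, j)))‖) ^ s ∂(wilsonMeasure (fundamentalRep (Fin 3)) (reg.β k))) / (∫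 U : GaugeConfig 4 (2 * S + 1) (Matrix.specialUnitaryGroup (Fin 3) ℂ), ‖(diracMatrix U fun fl => reg.mcrit k + reg.a k * m fl / reg.Zm k).det‖ ∂(wilsonMeasure (fundamentalRep (Fin 3)) (reg.β k))) ≤ C * Real.exp (-(δ * (reg.a k * ‖v‖)))) → ∃ δ' C' : ℝ, 0 < δ' ∧ ∀ᶠ k in atTop, ∀ S : ℕ, reg.L k ≤ S → ∀ n : ℕ, n ≤ S → qcdPhaseQuenchedExpect (reg.β k) (2 * S + 1) (fun fl => reg.mcrit k + reg.a k * m fl / reg.Zm k) (fun U : GaugeConfig 4 (2 * S + 1) SU3 => ∑ a : Fin 3, ∑ i : Fin 4, ∑ b : Fin 3, ∑ j : Fin 4, ‖(diracMatrix U fun fl => reg.mcrit k + reg.a k * m fl / reg.Zm k)⁻¹ (quarkEquiv (f, (Torus.proj (2 * S + 1) 0, a, i))) (quarkEquiv (f, (Torus.proj (2 * S + 1) (Pi.single 0 (n : ℤ)), b, j)))‖ ^ (2 : ℕ)) ≤ C' * Real.exp (-(δ' * (reg.a k * n))) := by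
  intro hcrux Nf reg m hm f g hfg hfgm hUp
  obtain ⟨δ', hδ', hC⟩ := hcrux Nf reg m hm hUp
  obtain ⟨C', hk⟩ := hC 1 1 (pseudoscalarDensityObs Nf (Matrix.single g f 1))
    (pseudoscalarDensityObs Nf (Matrix.single f g 1))
    ⟨f, 1, one_ne_zero, isFlavourCharged_pseudoscalarDensityObs_single hfg⟩
  refine ⟨δ', C', hδ', ?_⟩
  filter_upwards [hk] with k hk S hS n hn
  have key := hk S hS n hn
  set mq : Fin Nf → ℝ := fun fl => reg.mcrit k + reg.a k * m fl / reg.Zm k with hmqdef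
  have hmq : mq f = mq g := by simp only [hmqdef, hfgm]
  have hpt : ∀ U : GaugeConfig 4 (2 * S + 1) SU3,
      fermiIntegral ((pseudoscalarDensityObs Nf (Matrix.single g f 1)).onTorus (2 * S + 1) 0 U *
            (pseudoscalarDensityObs Nf (Matrix.single f g 1)).onTorus (2 * S + 1) (Pi.single 0 (n : ℤ)) U *
          fermiBoltzmann U mq) / fermiIntegral (fermiBoltzmann U mq) =
        -(((∑ a : Fin 3, ∑ i : Fin 4, ∑ b : Fin 3, ∑ j : Fin 4,
            ‖(diracMatrix U mq)⁻¹ (quarkEquiv (f, (Torus.proj (2 * S + 1) 0, a, i)))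
              (quarkEquiv (f, (Torus.proj (2 * S + 1) (Pi.single 0 (n : ℤ)), b, j)))‖ ^ (2 : ℕ) : ℝ) : ℂ)) :=
    fun U => by
      rw [pseudoscalarDensityObs_single_onTorus, pseudoscalarDensityObs_single_onTorus]
      exact pionPair_fermiRatio_eq U mq hfg hmq _ _
  rw [← qcdPhaseQuenchedExpect_eq_div_complex, qcdPhaseQuenchedExpect_eq_integral_qcdLatticeMeasure] at key
  simp only [hpt] at key
  rw [integral_neg, integral_complex_ofReal, norm_neg, Complex.norm_real, Real.norm_eq_abs] at key
  rw [qcdPhaseQuenchedExpect_eq_integral_qcdLatticeMeasure]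
  exact (le_abs_self _).trans key

end Summit.QuantumFields.QCD.Cruxes.PhaseQuenchedFlavourDecay.CrossingSplitIntegrability
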